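import Summits.AtomisticToContinuum.HydrodynamicLimit.Theorems.RelayRaceLocalityConeLocalisationElevatorDefs
import Summits.AtomisticToContinuum.HydrodynamicLimit.Theorems.RelayRaceLocalityNearConstantShortTimeHLTorusLipschitz
import Summits.AtomisticToContinuum.HydrodynamicLimit.Theorems.CollisionIsometryCLTCollisionalTransferLocalityFluxFormKinematics
import Literature.MathematicalPhysics.KineticTheory.HardSphereEulerPrimitiveForm
import Literature.Analysis.FunctionSpaces.TorusCalculusProofs
import Literature.Analysis.FluidPDE.HardSpherePhaseSpaceProofs
import HarnessLib

/-!
# RelayRaceLocality · ConeLocalisation — line `einstein-elevator`, stub `stub_straightness`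

Support file for the crux item `stmt-AtomisticToContinuum-12504` (`ConeLocalisation`, route RelayRaceLocality of
`AtomisticToContinuum/HydrodynamicLimit`), proving the registered stub

  `stub_straightness : DynamicLogSlopeBound → DynamicLogCurvatureBound → DynamicNearAtmosphere`

of the skeleton of the line `einstein-elevator` (Props in
`Theorems/RelayRaceLocalityConeLocalisationElevatorDefs.lean`): "steep ⇒ straight". The two dynamic
a-priori bounds give, floor-free, `|∂ᵢ log ρ| ≤ C₁ M^{a₁} / t` and `|∂ᵢ∂ⱼ log ρ| ≤ C₂ M^{a₂} / t` on
`[0, t] × 𝕋³` as soon as the level-`M` guards of `S` are alive on `[0, t]`. At the cone scale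
`ℓ₀ := t / (C Mᵃ)` (`C = 3 C₁`, `a = a₁`) the time-`0` datum is then, around EVERY point `x₀`, `δ`-near on
the ball of radius `K ℓ₀` (minimal-image chart `v = Torus.reprSym (x - x₀)`, `x = x₀ + proj v`,
`‖v‖ = Torus.euclidDist x x₀`) to the isothermal atmosphere fitted at `x₀` with the TRUE local slope
`g = ∇ log ρ(0, x₀)`:

* log-density: second-order Taylor along the segment `s ↦ x₀ + proj (s • v)`
  (`HemisphereAffineSlaving.abs_taylor_line_le`): the first-order term is `⟪g, v⟫` and the remainder is
  at most `(C₂ M^{a₂} / t) (Σₐ |vₐ|)² ≤ 9 K² C₂ M^{a₂} t / (C Mᵃ)² → 0`;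
* velocity and temperature: the guards `‖∂ᵢ u‖, |∂ᵢ θ| ≤ M` make `u 0`, `θ 0` `3M`-Lipschitz for the sup
  metric of `𝕋³` (`NearConstantShortTimeHL.we_norm_sub_le_of_norm_partialDeriv_le`), which is dominated
  by the minimal-image distance (`Torus.norm_sub_le_euclidDist_holds`); with `θ ≥ M⁻¹` this gives
  `‖u(x) - u(x₀)‖ ≤ 3 M K ℓ₀` and `|θ(x)/θ(x₀) - 1| ≤ 3 M² K ℓ₀`, both `∝ t → 0`;
* `‖g‖ ≤ Σᵢ |∂ᵢ log ρ(0, x₀)| ≤ 3 C₁ M^{a₁} / t = 1 / ℓ₀`.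

The horizon is `τ(M, K, δ) = min (1/(C₁M^{a₁}), 1/(C₂M^{a₂}), δ (C Mᵃ)² / (9 C₂ M^{a₂} K²), δ C Mᵃ / (3 M² K))`.
Pure calculus on `𝕋³` plus quantifier bookkeeping; no density floor enters.
-/

noncomputable section

namespace Summit.AtomisticToContinuum.HydrodynamicLimit.Theorems.ConeLocalisation.Elevator

namespace Straightness

open scoped Topology ContDiff NNReal
open Filter Set MeasureTheory
open Literature.MathematicalPhysics.KineticTheory Literature.Analysis.FluidPDE
  Literature.Analysis.FunctionSpaces

/-! ### Small statics on `ℝ³` and `𝕋³` -/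

/-- The slope vector with prescribed components `c` in the standard basis of `ℝ³` pairs with `w` to
`Σᵢ wᵢ cᵢ`. [folklore] -/
theorem inner_sum_smul_single (c : Fin 3 → ℝ) (w : V3) :
    inner ℝ (∑ i, c i • EuclideanSpace.single i (1 : ℝ) : V3) w = ∑ i, w i * c i := by
  simp [sum_inner, real_inner_smul_left, EuclideanSpace.inner_single_left, mul_comm]

/-- `‖Σᵢ cᵢ eᵢ‖ ≤ Σᵢ |cᵢ|` in `ℝ³`. [folklore] -/
theorem norm_sum_smul_single_le (c : Fin 3 → ℝ) :
    ‖(∑ i, c i • EuclideanSpace.single i (1 : ℝ) : V3)‖ ≤ ∑ i, |c i| := by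
  calc ‖(∑ i, c i • EuclideanSpace.single i (1 : ℝ) : V3)‖
      ≤ ∑ i, ‖c i • EuclideanSpace.single i (1 : ℝ)‖ := norm_sum_le _ _
    _ = ∑ i, |c i| := Finset.sum_congr rfl fun i _ => by
        rw [norm_smul, PiLp.norm_single, norm_one, mul_one, Real.norm_eq_abs]

/-- **First-order step.** A smooth field on `𝕋³` whose three partial derivatives are bounded by `Λ`
varies by at most `3 Λ ‖reprSym (x - x₀)‖` between `x₀` and `x`. [folklore] -/
theorem norm_sub_le_of_guard {F' : Type*} [NormedAddCommGroup F'] [NormedSpace ℝ F']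
    {f : T3 → F'} (hf : Torus.IsSmooth f) {Λ : ℝ} (hΛ : ∀ i y, ‖Torus.partialDeriv i f y‖ ≤ Λ)
    (x x₀ : T3) : ‖f x - f x₀‖ ≤ 3 * Λ * ‖Torus.reprSym (x - x₀)‖ := by
  have hΛ0 : 0 ≤ Λ := (norm_nonneg _).trans (hΛ 0 x)
  have h := NearConstantShortTimeHL.we_norm_sub_le_of_norm_partialDeriv_le hf hΛ x x₀
  refine h.trans (mul_le_mul_of_nonneg_left ?_ (by positivity))
  -- the sup distance of `𝕋³` is dominated by the minimal-image distance `‖reprSym (x - x₀)‖`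
  rw [dist_eq_norm]
  exact Torus.norm_sub_le_euclidDist_holds x x₀

end Straightness

open scoped Topology ContDiff NNReal
open Filter Set MeasureTheory
open Literature.MathematicalPhysics.KineticTheory Literature.Analysis.FluidPDE
  Literature.Analysis.FunctionSpaces
open Straightness

/-! ### The stub -/

/-- **STUB `stub_straightness` of the line `einstein-elevator`** (registered on
stmt-AtomisticToContinuum-12504): "steep ⇒ straight" — the dynamic log-slope and log-curvature bounds of
the guard class make the time-`0` datum, around every point and at the cone scale `ℓ₀ = t / (C Mᵃ)`,
`δ`-near on the ball of radius `K ℓ₀` to the isothermal atmosphere with the true local slope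
`g = ∇ log ρ(0, x₀)`, `‖g‖ ℓ₀ ≤ 1` (second-order Taylor in the minimal-image chart; velocity and
temperature by the guards `‖∂u‖, |∂θ| ≤ M`, `θ ≥ M⁻¹`). [folklore] -/
theorem stub_straightness : DynamicLogSlopeBound → DynamicLogCurvatureBound → DynamicNearAtmosphere := by
  rintro ⟨η₁', hη₁', C₁, hC₁, a₁, H₁⟩ ⟨η₂', hη₂', C₂, hC₂, a₂, H₂⟩
  refine ⟨min η₁' η₂', lt_min hη₁' hη₂', 3 * C₁, by positivity, a₁, ?_⟩
  intro M hM K hK δ hδ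
  have hM0 : 0 < M := by linarith
  have hK0 : 0 < K := by linarith
  -- the constants at level `M`
  set P₁ : ℝ := C₁ * M ^ a₁ with hP₁
  set P₂ : ℝ := C₂ * M ^ a₂ with hP₂
  set L : ℝ := 3 * C₁ * M ^ a₁ with hL
  have hP₁0 : 0 < P₁ := by positivity
  have hP₂0 : 0 < P₂ := by positivity
  have hL0 : 0 < L := by positivity
  have hLP : L = 3 * P₁ := by rw [hL, hP₁]; ring
  refine ⟨min (1 / P₁) (min (1 / P₂) (min (δ * L ^ 2 / (9 * P₂ * K ^ 2)) (δ * L / (3 * M ^ 2 * K)))),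
    by positivity, ?_⟩
  intro σ T ρ θ u hσ hσ1 hE t ht0 htT htτ hG x₀
  -- unpacking `t ≤ τ`
  have ht1 : t * P₁ ≤ 1 := (le_div_iff₀ hP₁0).1 (htτ.trans (min_le_left _ _))
  have ht2 : t * P₂ ≤ 1 :=
    (le_div_iff₀ hP₂0).1 (htτ.trans ((min_le_right _ _).trans (min_le_left _ _)))
  have ht3 : t * (9 * P₂ * K ^ 2) ≤ δ * L ^ 2 := (le_div_iff₀ (by positivity)).1
    (htτ.trans ((min_le_right _ _).trans ((min_le_right _ _).trans (min_le_left _ _))))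
  have ht4 : t * (3 * M ^ 2 * K) ≤ δ * L := (le_div_iff₀ (by positivity)).1
    (htτ.trans ((min_le_right _ _).trans ((min_le_right _ _).trans (min_le_right _ _))))
  have htne : t ≠ 0 := ht0.ne'
  -- the guards for the two bands, and at time `0`
  have hG₁ : ∀ s ∈ Icc 0 t, ∀ x, GuardAt η₁' M σ ρ θ u s x := fun s hs x =>
    ⟨(hG s hs x).1.trans_le (min_le_left _ _), (hG s hs x).2⟩
  have hG₂ : ∀ s ∈ Icc 0 t, ∀ x, GuardAt η₂' M σ ρ θ u s x := fun s hs x =>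
    ⟨(hG s hs x).1.trans_le (min_le_right _ _), (hG s hs x).2⟩
  have h0t : (0 : ℝ) ∈ Icc 0 t := ⟨le_rfl, ht0.le⟩
  have h0T : (0 : ℝ) ∈ Ico 0 T := ⟨le_rfl, ht0.trans htT⟩
  -- the log-density slice at time `0` and its derivative bounds
  have hfS : Torus.IsSmooth (fun y => Real.log (ρ 0 y)) :=
    (HsEulerCalc.isSmoothSpaceTimeOn_comp_density hE.smooth_density Real.contDiffOn_log
      (fun s hs y => (hE.density_pos s hs y).ne')).isSmooth_slice h0T
  set f : T3 → ℝ := fun y => Real.log (ρ 0 y) with hf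
  have hD1 : ∀ i, |Torus.partialDeriv i f x₀| ≤ P₁ / t := fun i =>
    H₁ M hM σ T ρ θ u hσ hσ1 hE t ht0 htT ht1 hG₁ 0 h0t x₀ i
  have hD2 : ∀ i j y, |Torus.partialDeriv i (Torus.partialDeriv j f) y| ≤ P₂ / t := fun i j y =>
    H₂ M hM σ T ρ θ u hσ hσ1 hE t ht0 htT ht2 hG₂ 0 h0t y i j
  -- the slope vector `g = ∇ log ρ(0, x₀)`
  set g : V3 := ∑ i, Torus.partialDeriv i f x₀ • EuclideanSpace.single i (1 : ℝ) with hg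
  have hg_norm : ‖g‖ ≤ 3 * (P₁ / t) := by
    refine (norm_sum_smul_single_le _).trans ?_
    have h := fun i => hD1 i
    simp only [Fin.sum_univ_three]
    linarith [h 0, h 1, h 2]
  refine ⟨g, ?_, fun x hx => ?_⟩
  · -- `‖g‖ ℓ₀ ≤ 1`
    calc ‖g‖ * (t / L) ≤ 3 * (P₁ / t) * (t / L) :=
          mul_le_mul_of_nonneg_right hg_norm (by positivity)
      _ = 1 := by rw [hLP]; field_simp
  · -- nearness on the ball of radius `K ℓ₀` about `x₀`
    set v : V3 := Torus.reprSym (x - x₀) with hv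
    have hxv : x₀ + Torus.proj v = x := by rw [hv, Torus.proj_reprSym, add_sub_cancel]
    have hvn : ‖v‖ < K * (t / L) := by rwa [Torus.euclidDist_eq] at hx
    have hr0 : 0 ≤ K * (t / L) := by positivity
    refine ⟨?_, ?_, ?_⟩
    · -- (a) log-density: second-order Taylor along the segment
      have hT := HemisphereAffineSlaving.abs_taylor_line_le hfS hD2 x₀ v
      rw [hxv] at hT
      rw [inner_sum_smul_single]
      refine hT.trans ?_
      have hva : ∀ a, |v a| ≤ ‖v‖ := fun a => by
        rw [← Real.norm_eq_abs]
        exact PiLp.norm_apply_le v a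
      have hs : ∑ a, |v a| ≤ 3 * (K * (t / L)) := by
        simp only [Fin.sum_univ_three]
        linarith [hva 0, hva 1, hva 2]
      calc P₂ / t * (∑ a, |v a|) ^ 2 ≤ P₂ / t * (3 * (K * (t / L))) ^ 2 := by gcongr
        _ = t * (9 * P₂ * K ^ 2) / L ^ 2 := by field_simp; ring
        _ ≤ δ := by rw [div_le_iff₀ (by positivity)]; exact ht3
    · -- (b) velocity
      have hus : Torus.IsSmooth (u 0) := hE.smooth_velocity.isSmooth_slice h0T
      have hdu : ∀ i y, ‖Torus.partialDeriv i (u 0) y‖ ≤ M := fun i y =>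
        ((hG 0 h0t y).2.2.2.2.2 i 0 0).2.1
      have key : 3 * M * K * t * 1 ≤ 3 * M * K * t * M :=
        mul_le_mul_of_nonneg_left hM (by positivity)
      calc ‖u 0 x - u 0 x₀‖ ≤ 3 * M * ‖v‖ := norm_sub_le_of_guard hus hdu x x₀
        _ ≤ 3 * M * (K * (t / L)) := by gcongr
        _ = 3 * M * K * t / L := by ring
        _ ≤ δ := by rw [div_le_iff₀ hL0]; linarith
    · -- (c) temperature
      have hθs : Torus.IsSmooth (θ 0) := hE.smooth_temperature.isSmooth_slice h0T
      have hdθ : ∀ i y, ‖Torus.partialDeriv i (θ 0) y‖ ≤ M := fun i y => by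
        rw [Real.norm_eq_abs]
        exact ((hG 0 h0t y).2.2.2.2.2 i 0 0).2.2.1
      have hθpos : 0 < θ 0 x₀ := hE.temperature_pos 0 h0T x₀
      have hθinv : M⁻¹ ≤ θ 0 x₀ := (hG 0 h0t x₀).2.2.2.1
      have hMθ : 1 ≤ M * θ 0 x₀ := by
        have h := mul_le_mul_of_nonneg_left hθinv hM0.le
        rwa [mul_inv_cancel₀ hM0.ne'] at h
      have h1 : |θ 0 x - θ 0 x₀| ≤ 3 * M * (K * (t / L)) := by
        rw [← Real.norm_eq_abs]
        exact (norm_sub_le_of_guard hθs hdθ x x₀).trans (by gcongr)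
      have hq : 3 * M * (K * (t / L)) * M ≤ δ := by
        rw [show 3 * M * (K * (t / L)) * M = t * (3 * M ^ 2 * K) / L by ring, div_le_iff₀ hL0]
        exact ht4
      rw [div_sub_one hθpos.ne', abs_div, abs_of_pos hθpos, div_le_iff₀ hθpos]
      calc |θ 0 x - θ 0 x₀| ≤ 3 * M * (K * (t / L)) := h1
        _ ≤ 3 * M * (K * (t / L)) * (M * θ 0 x₀) := le_mul_of_one_le_right (by positivity) hMθ
        _ = 3 * M * (K * (t / L)) * M * θ 0 x₀ := by ring
        _ ≤ δ * θ 0 x₀ := mul_le_mul_of_nonneg_right hq hθpos.le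

end Summit.AtomisticToContinuum.HydrodynamicLimit.Theorems.ConeLocalisation.Elevator

end
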